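import Summits.BirchSwinnertonDyer.Rank1Residual.Supersingular.SignedLambdaParityTwoMazurTate
import HarnessLib

/-!
# PARITY(2), part 2: `(−1)^{λ(θ_n(f))} = (−1)^{λ(L♯₂)} = −(−1)^{λ(L♭₂)} = χ₈(N) = (2/N)` at a good
# SUPERSINGULAR `2`, for every `a₂ ∈ {0, +2, −2}` (cell `b2b-bsdres`, O1 sub-cell `p = 2`;
# lens-1 GEN 8 packet, ported by cc-typer-4 GEN 5 as typer item (23′); part 1 =
# `SignedLambdaParityTwoMazurTate.lean`: §1–§3, the characteristic-2 mechanism and the Θ-level law)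

HONEST FRAMING (run/shared/lean/b2b/bsd-rank1-residual/, verbatim in every file): the goal of the
cell is to DELETE the COMBINATION-SHAPED residual classes of the Birch–Swinnerton-Dyer formula for
ALL analytic-rank `≤ 1` elliptic curves over `ℚ` — "full BSD formula for every rank `≤ 1` curve in
class `C`" assembled STRICTLY from published theorems — so that the rank-`≤ 1` remainder becomes
exactly the CONSTRUCTION-SHAPED classes, which are TYPED (missing-input `Prop`s), NOT attempted.
This is not "finishing BSD". THEOREMS ONLY (no definition, no named fact; every hypothesis explicit —
`IsNewformOf`, good reduction at `2`, `2 ∣ a₂`, a Sprung pair, `L ≠ 0`, `μ(L) = 0`; nothing about any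
particular curve is asserted; nothing booked; labels unchanged).

CREDIT. This file is the o1 lens-1 GEN 8 packet `HOME/b2b-bsdres-o1-idea-1-g8/lean/G8_MTParityTwo.lean`
(planner-b2b-bsdres-o1-idea-1-g8-0, 2026-08-21T14:01Z; sha16 of the source `fd24c5857114f6b5`;
lead-verified rc 0, o1 lead GEN 19 C147 / R-G19.8), ported verbatim up to the namespace
(`LensOneG8` → this file's namespace) and this docstring, per the one-writer rule (typer item (23′),
queue v3.7c; split in two files by the 400-line rule: THIS file = §3b–§4). It is the `p = 2` companion of `SignedLambdaParity.lean` (odd `p`: `(−1)^{λ(L♯)} = σ`).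

## What this file proves

MECHANISM.  The odd-`p` theorem `neg_one_pow_lam_mazurTate` reads the Mazur–Tate functional equation
`θ_n(T) ≡ σ (1+T)^c θ_n((1+T)^{-1} − 1) (mod ω_n)` modulo `(p, T^{pⁿ})` at the coefficient of `T^λ`,
`λ = ord_T θ̄_n`; at `p = 2` that comparison is empty (`−1 = 1`).  The coefficient of `T^{λ+1}` is
not: since `(1+T)^{2ⁿ−1} − 1 = T + binom(2ⁿ−1, 2) T² + ⋯` with `binom(2ⁿ−1, 2)` odd (`n ≥ 2`), it gives
**`c + λ ≡ 0 (mod 2)`** (`even_add_natTrailingDegree_of_dvd_charTwo`, pure algebra over any field of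
characteristic `2`), where `c = (−s_N) mod 2ⁿ` is the Fricke exponent, `η_N · 5^{s_N} = N` in
`ℤ/2^{n+2}` (`cyclotomicGenerator 2 = 5`, `cyclotomicExponent 2 = 2`, `torsionOrder 2 = 2`), and
`5^s ≡ 1, 5 (mod 8)` for `s` even, odd gives `(−1)^{s_N} = χ₈(N)` (`neg_one_pow_val_eq_chi8`).  Hence
`(−1)^{λ(Θ)} = χ₈(N)` for any `Θ ∈ ℤ₂⟦T⟧` lifting `θ_n` with `μ(Θ) = 0`, `λ(Θ) + 2 ≤ 2ⁿ`
(`neg_one_pow_lam_mazurTate_two`; the sign `σ` is used only through `σ̄ = 1` in `𝔽₂`), and even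
without `μ(Θ) = 0` (`neg_one_pow_lam_mazurTate_two'`, §3b: divide out `2^μ` against the monic `ω_n`).
Transfer to the Sprung pair: `θ_n = ω_n Q_n − (u_n L♯ + v_n L♭)` integrally
(`exists_integral_mazurTate_of_isSprungPair_two`, from `exists_integral_isSprungPair_two` +
`IsSprungPair.unique`, hypothesis `2 ∣ a₂` only), the tree's p-uniform mod-`p` layer readings
`lam_eq_lam_add_of_mu_eq_zero_of_odd/even` (`λ(θ_n) = λ(L♯) + deg ω_n⁺` on odd layers,
`= λ(L♭) + deg ω_n⁻` on even layers), and AT `p = 2`: `deg ω_n⁺ = 2 + 8 + 32 + ⋯` is EVEN,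
`deg ω_n⁻ = 1 + 4 + 16 + ⋯` is ODD (`even_natDegree_cyclotomicOmegaPlus_two`,
`odd_natDegree_cyclotomicOmegaMinus_two`).  RESULTS: `neg_one_pow_lam_sharp_two`, `neg_one_pow_lam_flat_two`,
`odd_lam_sharp_add_lam_flat_two`, `even_lam_sharp_two_iff` (`Even λ♯ ↔ N ≡ ±1 (8)`),
`even_lam_flat_two_iff` (`Even λ♭ ↔ N ≡ ±3 (8)`) — the o1 census law PARITY(2) (2 922/2 922, lens-1
GEN 6; EVIDENCE, not used) as a theorem for all three supersingular traces, with NO `Log`–`ι`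
transformation law and no completed pair.  (For `a₂ = 0` the full functional equations of `L♯, L♭`
themselves — Sprung 2017 Cor. 4.14 at `p = 2` — are in
`Literature/Barriers/BirchSwinnertonDyer/PAdicFunctionalEquationSharpFlatTwoProofs`.)
Inputs from the tree, all valid at ANY prime: `cyclotomicOmega_dvd_mazurTateElement_sub`,
`exists_classMap_eq_natCast`, `X_pow_dvd_reduction_sub_of_mazurTate`, `red_eq_coe_map_trunc_of_mazurTate`,
`mu_eq_zero_and_lam_eq_of_red_ne_zero`, `exists_odd_layer` / `exists_even_layer`,
`exists_sign_isFrickeEigen`, `not_dvd_level_of_isNewformOf`, and at `p = 2` Sprung's pair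
`exists_integral_isSprungPair_two` (typer item (22), p274088).
-/

set_option autoImplicit false

noncomputable section

open scoped Classical MatrixGroups ModularForm

open Polynomial

namespace Summit.BirchSwinnertonDyer.Rank1Residual.Supersingular

open CongruenceSubgroup WeierstrassCurve Literature.NumberTheory.EllipticCurves
  Literature.NumberTheory.EllipticCurves.ModularForms
  Literature.NumberTheory.EllipticCurves.Sprung2017
  Summit.BirchSwinnertonDyer.Rank1Residual.X1.MuLambda

variable {N : ℕ} [NeZero N] {f : CuspForm (Gamma0 N) 2}

/-! ## §3b. Dropping `μ = 0` at the `Θ`-level: divide out `2^{μ}`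

`λ(Θ)` is by definition the order of the reduction of the `2`-free part `pfree Θ = Θ / 2^{μ(Θ)}`, and
the functional equation is LINEAR, so it holds for `pfree Θ` as well (cancel `2^{μ}` against the
monic `ω_n` in `ℤ₂[X]`).  Hence the parity law needs NO `μ = 0` hypothesis: relevant at `p = 2`, where
`μ(θ_n) > 0` does occur (e.g. curves with a rational `2`-torsion point). -/

/-- Monic cancellation: `q` monic, `a ≠ 0`, `q ∣ C a · A` in `R[X]` (`R` a domain) ⇒ `q ∣ A`. -/
theorem dvd_of_monic_of_dvd_C_mul {R : Type*} [CommRing R] [IsDomain R] {q A : R[X]}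
    (hq : q.Monic) {a : R} (ha : a ≠ 0) (h : q ∣ C a * A) : q ∣ A := by
  rw [← modByMonic_eq_zero_iff_dvd hq] at h ⊢
  rw [← smul_eq_C_mul, smul_modByMonic, smul_eq_C_mul] at h
  exact (mul_eq_zero.mp h).resolve_left fun h0 => ha (C_eq_zero.mp h0)

/-- **Exponent form, `μ`-free.** As `even_val_neg_add_lam_mazurTate_two` but WITHOUT `μ(Θ) = 0`:
`Θ ≠ 0`, `λ(Θ) + 2 ≤ 2ⁿ` suffice. -/
theorem even_val_neg_add_lam_mazurTate_two' {σ : ℤ} (hσ : σ = 1 ∨ σ = -1)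
    (hW : IsFrickeEigen N f (-(σ : ℂ))) {n : ℕ} (hn : 2 ≤ n)
    {ηN : rootsOfUnity (torsionOrder 2) ℤ_[2]} {sN : ZMod (2 ^ n)}
    (hN : PadicInt.toZModPow (n + cyclotomicExponent 2) ((ηN : ℤ_[2]ˣ) : ℤ_[2]) *
        (cyclotomicGenerator 2 : ZMod (2 ^ (n + cyclotomicExponent 2))) ^ sN.val =
          (N : ZMod (2 ^ (n + cyclotomicExponent 2))))
    {Θ : IwasawaAlgebra 2}
    (hΘ : iwasawaToPowerSeries 2 Θ =
      ((mazurTateElement f 2 n).map (algebraMap ℚ ℚ_[2]) : PowerSeries ℚ_[2]))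
    (hΘ0 : Θ ≠ 0) (hlt : lam Θ + 2 ≤ 2 ^ n) :
    Even ((-sN).val + lam Θ) := by
  haveI := charP_residueField_two
  have hσ2 : σ ^ 2 = 1 := by rcases hσ with rfl | rfl <;> norm_num
  have hFE := cyclotomicOmega_dvd_mazurTateElement_sub hσ2 hW n hN
  have hpn : 1 ≤ 2 ^ n := Nat.one_le_two_pow
  -- the integral functional equation for the truncation of `Θ`
  have hint := omega_dvd_trunc_sub_of_mazurTate hFE hΘ
  -- `Θ = 2^μ · Θ₀`, `Θ₀ = pfree Θ`
  set Θ₀ : IwasawaAlgebra 2 := pfree Θ with hΘ₀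
  set a : ℤ_[2] := ((2 : ℕ) : ℤ_[2]) ^ mu Θ with ha_def
  have ha : a ≠ 0 := pow_ne_zero _ (by simp)
  have hfac : Θ = PowerSeries.C a * Θ₀ := eq_C_pow_mu_mul_pfree Θ
  set T₀ : ℤ_[2][X] := PowerSeries.trunc (2 ^ n) Θ₀ with hT₀
  have hT : PowerSeries.trunc (2 ^ n) Θ = C a * T₀ := by
    conv_lhs => rw [hfac]
    rw [PowerSeries.trunc_C_mul]
  -- cancel `2^μ` against the monic `ω_n`
  have hint₀ : ((X + 1 : ℤ_[2][X]) ^ 2 ^ n - 1) ∣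
      T₀ - C (σ : ℤ_[2]) * ((X + 1) ^ (-sN).val * T₀.comp ((X + 1) ^ (2 ^ n - 1) - 1)) := by
    rw [hT] at hint
    have hrw : C a * T₀ - C (σ : ℤ_[2]) * ((X + 1) ^ (-sN).val *
        (C a * T₀).comp ((X + 1) ^ (2 ^ n - 1) - 1)) =
        C a * (T₀ - C (σ : ℤ_[2]) * ((X + 1) ^ (-sN).val *
          T₀.comp ((X + 1) ^ (2 ^ n - 1) - 1))) := by
      rw [C_mul_comp]; ring
    rw [hrw] at hint
    exact dvd_of_monic_of_dvd_C_mul (monic_X_add_one_pow_sub_one hpn) ha hint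
  -- reduce modulo `2`: `ω_n ≡ X^{2ⁿ}`
  set Θbar : (IsLocalRing.ResidueField ℤ_[2])[X] := T₀.map (IsLocalRing.residue ℤ_[2]) with hΘbar
  have hdvd : (X : (IsLocalRing.ResidueField ℤ_[2])[X]) ^ 2 ^ n ∣
      Θbar - C (σ : IsLocalRing.ResidueField ℤ_[2]) * ((X + 1) ^ (-sN).val *
        Θbar.comp ((X + 1) ^ (2 ^ n - 1) - 1)) := by
    have h1 := Polynomial.map_dvd (IsLocalRing.residue ℤ_[2]) hint₀
    have hω : (((X + 1 : ℤ_[2][X]) ^ 2 ^ n - 1)).map (IsLocalRing.residue ℤ_[2]) =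
        (X : (IsLocalRing.ResidueField ℤ_[2])[X]) ^ 2 ^ n := by
      rw [← map_cyclotomicOmega (p := 2) (Int.castRingHom ℤ_[2]) n, Polynomial.map_map,
        map_residue_cyclotomicOmega]
    rw [hω] at h1
    simpa [Polynomial.map_sub, Polynomial.map_mul, Polynomial.map_comp] using h1
  -- `red Θ₀` is the reduction of `T₀`
  have hcoe : ((T₀ : ℤ_[2][X]) : PowerSeries ℤ_[2]) = Θ₀ := by
    ext i
    rw [hT₀, Polynomial.coeff_coe, PowerSeries.coeff_trunc]
    split_ifs with hi
    · rfl
    · have h0 := coeff_eq_zero_of_iwasawaToPowerSeries_eq hΘ (not_lt.mp hi)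
      rw [hfac, PowerSeries.coeff_C_mul] at h0
      exact ((mul_eq_zero.mp h0).resolve_left ha).symm
  have hred : red Θ₀ = (Θbar : PowerSeries (IsLocalRing.ResidueField ℤ_[2])) := by
    rw [hΘbar, Polynomial.polynomial_map_coe, hcoe]
  have hredne : red Θ₀ ≠ 0 := red_pfree_ne_zero hΘ0
  have hΘbar0 : Θbar ≠ 0 := by
    intro h0
    exact hredne (by rw [hred, h0, Polynomial.coe_zero])
  have hlam : lam Θ = Θbar.natTrailingDegree := by
    show (red (pfree Θ)).order.toNat = _
    rw [← hΘ₀, hred, order_coe_eq_natTrailingDegree hΘbar0]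
    rfl
  -- `σ̄ = 1` in characteristic `2`, and conclude by the second-coefficient lemma
  have hσbar : ((σ : IsLocalRing.ResidueField ℤ_[2])) = 1 := by
    rcases hσ with rfl | rfl
    · push_cast; rfl
    · push_cast; exact CharTwo.neg_eq 1
  rw [hσbar, C_1, one_mul] at hdvd
  have h4 : 4 ∣ 2 ^ n := by
    have h := Nat.pow_dvd_pow 2 hn
    norm_num at h
    exact h
  have key := even_add_natTrailingDegree_of_dvd_charTwo hΘbar0 h4
    (by rw [← hlam]; exact hlt) hdvd
  rwa [← hlam] at key

/-- **`(−1)^{λ(θ_n)} = χ₈(N)`, `μ`-free.** `f ∈ S₂(Γ₀(N))` with a Fricke sign, `2 ∤ N`, `n ≥ 2`,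
`Θ ∈ Λ` with `ι Θ = θ_n(f)`, `Θ ≠ 0`, `λ(Θ) + 2 ≤ 2ⁿ` — no condition on `μ(Θ)`. -/
theorem neg_one_pow_lam_mazurTate_two' {σ : ℤ} (hσ : σ = 1 ∨ σ = -1)
    (hW : IsFrickeEigen N f (-(σ : ℂ))) (hN2 : ¬ 2 ∣ N) {n : ℕ} (hn : 2 ≤ n) {Θ : IwasawaAlgebra 2}
    (hΘ : iwasawaToPowerSeries 2 Θ =
      ((mazurTateElement f 2 n).map (algebraMap ℚ ℚ_[2]) : PowerSeries ℚ_[2]))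
    (hΘ0 : Θ ≠ 0) (hlt : lam Θ + 2 ≤ 2 ^ n) :
    (-1 : ℤ) ^ lam Θ = ZMod.χ₈ (N : ZMod 8) := by
  haveI : NeZero (2 ^ n) := ⟨pow_ne_zero _ two_ne_zero⟩
  obtain ⟨ηN, sN, hN⟩ := exists_classMap_eq_natCast 2 n hN2
  have hev := even_val_neg_add_lam_mazurTate_two' hσ hW hn hN hΘ hΘ0 hlt
  have hχ := neg_one_pow_val_eq_chi8 (by omega : 1 ≤ n) hN
  have hsum : Even ((-sN).val + sN.val) := by
    have h := ZMod.val_add (-sN) sN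
    rw [neg_add_cancel, ZMod.val_zero] at h
    have hdvd : 2 ^ n ∣ (-sN).val + sN.val := Nat.dvd_of_mod_eq_zero h.symm
    exact even_iff_two_dvd.mpr ((dvd_pow_self 2 (by omega)).trans hdvd)
  have e1 : (-1 : ℤ) ^ lam Θ * (-1) ^ (-sN).val = 1 := by
    rw [← pow_add, add_comm]; exact hev.neg_one_pow
  have e2 : (-1 : ℤ) ^ (-sN).val * (-1) ^ sN.val = 1 := by
    rw [← pow_add]; exact hsum.neg_one_pow
  calc (-1 : ℤ) ^ lam Θ = (-1) ^ lam Θ * ((-1) ^ (-sN).val * (-1) ^ sN.val) := by rw [e2, mul_one]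
    _ = ((-1) ^ lam Θ * (-1) ^ (-sN).val) * (-1) ^ sN.val := by ring
    _ = (-1) ^ sN.val := by rw [e1, one_mul]
    _ = ZMod.χ₈ (N : ZMod 8) := hχ

/-- **`λ(θ_n)` is even iff `N ≡ ±1 (mod 8)`, `μ`-free.** -/
theorem even_lam_mazurTate_two_iff' {σ : ℤ} (hσ : σ = 1 ∨ σ = -1)
    (hW : IsFrickeEigen N f (-(σ : ℂ))) (hN2 : ¬ 2 ∣ N) {n : ℕ} (hn : 2 ≤ n) {Θ : IwasawaAlgebra 2}
    (hΘ : iwasawaToPowerSeries 2 Θ =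
      ((mazurTateElement f 2 n).map (algebraMap ℚ ℚ_[2]) : PowerSeries ℚ_[2]))
    (hΘ0 : Θ ≠ 0) (hlt : lam Θ + 2 ≤ 2 ^ n) :
    Even (lam Θ) ↔ N % 8 = 1 ∨ N % 8 = 7 := by
  have key := neg_one_pow_lam_mazurTate_two' hσ hW hN2 hn hΘ hΘ0 hlt
  rw [ZMod.χ₈_nat_eq_if_mod_eight, if_neg (by omega)] at key
  constructor
  · intro hev
    by_contra hne
    rw [hev.neg_one_pow, if_neg hne] at key
    norm_num at key
  · intro h8
    rw [if_pos h8] at key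
    exact (neg_one_pow_eq_one_iff_even (by norm_num)).mp key

/-! ## §4. Transfer to the Sprung pair at `2` — EVERY `a₂ ∈ {0, ±2}` -/

/-- `deg ω_n^+ = ∑_{1 ≤ k ≤ n/2} φ(2^{2k})` is even at `p = 2` (each `φ(2^{2k}) = 2^{2k−1}`). -/
theorem even_natDegree_cyclotomicOmegaPlus_two (n : ℕ) :
    Even (cyclotomicOmegaPlus 2 n).natDegree := by
  rw [natDegree_cyclotomicOmegaPlus, even_iff_two_dvd]
  refine Finset.dvd_sum fun k hk => ?_
  rw [Finset.mem_Icc] at hk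
  rw [Nat.totient_prime_pow Nat.prime_two (by omega)]
  exact Dvd.dvd.mul_right (dvd_pow_self 2 (by omega)) _

/-- `deg ω_n^- = ∑_{1 ≤ k ≤ (n+1)/2} φ(2^{2k−1}) = 1 + 4 + 16 + ⋯` is ODD at `p = 2` for `n ≥ 1`. -/
theorem odd_natDegree_cyclotomicOmegaMinus_two {n : ℕ} (hn : 1 ≤ n) :
    Odd (cyclotomicOmegaMinus 2 n).natDegree := by
  have hmem : 1 ∈ Finset.Icc 1 ((n + 1) / 2) := Finset.mem_Icc.mpr ⟨le_rfl, by omega⟩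
  rw [natDegree_cyclotomicOmegaMinus, ← Finset.sum_erase_add _ _ hmem]
  have h1 : Nat.totient (2 ^ (2 * 1 - 1)) = 1 := by norm_num
  rw [h1]
  refine Even.add_odd ?_ odd_one
  rw [even_iff_two_dvd]
  refine Finset.dvd_sum fun k hk => ?_
  rw [Finset.mem_erase, Finset.mem_Icc] at hk
  rw [Nat.totient_prime_pow Nat.prime_two (by omega)]
  exact Dvd.dvd.mul_right (dvd_pow_self 2 (by omega)) _

section TransferTwo

variable {W : WeierstrassCurve ℚ} [W.IsElliptic] [W.IsGloballyMinimal]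

/-- The `p = 2` clone of `exists_integral_mazurTate_of_isSprungPair`: every `θ_n` (level `2^{n+2}`)
is `ι(ω_n Q_n − (u_n L♯ + v_n L♭))` for THE Sprung pair at `2` (integrality:
`exists_integral_isSprungPair_two`, p274088; uniqueness `IsSprungPair.unique`, `2 ∣ a₂`). -/
theorem exists_integral_mazurTate_of_isSprungPair_two (hf : IsNewformOf W f)
    (hgood : W.HasGoodReductionAtPrime 2) (hap : (2 : ℤ) ∣ W.frobeniusTrace 2)
    {Lsharp Lflat : IwasawaAlgebra 2} (hSP : IsSprungPair f 2 (W.frobeniusTrace 2) Lsharp Lflat)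
    (n : ℕ) :
    ∃ Q : IwasawaAlgebra 2, ((mazurTateElement f 2 n).map (algebraMap ℚ ℚ_[2]) : PowerSeries ℚ_[2]) =
      iwasawaToPowerSeries 2 (toIwasawa 2 (cyclotomicOmega 2 n) * Q -
        (toIwasawa 2 (sharpPoly (W.frobeniusTrace 2) 2 n) * Lsharp +
          toIwasawa 2 (flatPoly (W.frobeniusTrace 2) 2 n) * Lflat)) := by
  obtain ⟨Ls, Lf, hLsLf⟩ := exists_integral_isSprungPair_two hf.1 hf.coeffField_eq_bot
    (not_dvd_level_of_isNewformOf hf hgood) (cuspCoeff_eq_frobeniusTrace_of_isNewformOf_holds hf hgood)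
    hap
  have hSP' : IsSprungPair f 2 (W.frobeniusTrace 2) Ls Lf := by
    intro m
    obtain ⟨Q, hQ⟩ := hLsLf m
    refine ⟨0, Q, ?_⟩
    rw [pow_zero, map_one, one_mul, Polynomial.map_neg, Polynomial.map_one, Polynomial.coe_neg,
      Polynomial.coe_one, neg_one_mul, map_neg, sub_neg_eq_add, hQ]
  obtain ⟨h1, h2⟩ := hSP.unique hap hSP'
  subst h1 h2
  obtain ⟨Q, hQ⟩ := hLsLf n
  refine ⟨Q, ?_⟩
  rw [map_sub, toIwasawa_apply (p := 2) (cyclotomicOmega 2 n), ← hQ]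
  ring

/-- **PARITY(2), ♯ — `(−1)^{λ(L♯₂(E))} = χ₈(N) = (2/N)`** for `E = W` with good SUPERSINGULAR
reduction at `2` (`2 ∣ a₂(E)`: `a₂ ∈ {0, +2, −2}`, all three), `f` its newform (any level `N`,
`2 ∤ N` automatic), ANY (= the) Sprung pair at `2` with `L♯ ≠ 0`, `μ(L♯) = 0`. -/
theorem neg_one_pow_lam_sharp_two (hf : IsNewformOf W f) (hgood : W.HasGoodReductionAtPrime 2)
    (hap : (2 : ℤ) ∣ W.frobeniusTrace 2) {Lsharp Lflat : IwasawaAlgebra 2}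
    (hSP : IsSprungPair f 2 (W.frobeniusTrace 2) Lsharp Lflat) (hL0 : Lsharp ≠ 0)
    (hμ : mu Lsharp = 0) : (-1 : ℤ) ^ lam Lsharp = ZMod.χ₈ (N : ZMod 8) := by
  obtain ⟨σ, hσ, -, hW⟩ := exists_sign_isFrickeEigen hf
  obtain ⟨n, hn, hlt⟩ := exists_odd_layer 2 (lam Lsharp + 2)
  have hn2 : 2 ≤ n := by
    have h3 : 3 ≤ 2 ^ n := by omega
    rcases Nat.lt_or_ge n 2 with h | h
    · interval_cases n <;> simp at h3
    · exact h
  obtain ⟨Q, hQ⟩ := exists_integral_mazurTate_of_isSprungPair_two hf hgood hap hSP n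
  obtain ⟨hΘ0, hμΘ, hlamΘ⟩ := lam_eq_lam_add_of_mu_eq_zero_of_odd hap hn rfl hL0 hμ
    (by omega : lam Lsharp + (cyclotomicOmegaPlus 2 n).natDegree < 2 ^ n)
  have hbd : ∀ {Θ : IwasawaAlgebra 2} {d : ℕ}, lam Lsharp + 2 + d < 2 ^ n → lam Θ = lam Lsharp + d →
      lam Θ + 2 ≤ 2 ^ n := by intros; omega
  have key := neg_one_pow_lam_mazurTate_two hσ hW (not_dvd_level_of_isNewformOf hf hgood) hn2
    hQ.symm hΘ0 hμΘ (hbd hlt hlamΘ)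
  rwa [hlamΘ, pow_add, (even_natDegree_cyclotomicOmegaPlus_two n).neg_one_pow, mul_one] at key

/-- **PARITY(2), ♭ — `(−1)^{λ(L♭₂(E))} = −χ₈(N)`** (even layer; `deg ω_n^-` is ODD at `2`). -/
theorem neg_one_pow_lam_flat_two (hf : IsNewformOf W f) (hgood : W.HasGoodReductionAtPrime 2)
    (hap : (2 : ℤ) ∣ W.frobeniusTrace 2) {Lsharp Lflat : IwasawaAlgebra 2}
    (hSP : IsSprungPair f 2 (W.frobeniusTrace 2) Lsharp Lflat) (hL0 : Lflat ≠ 0)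
    (hμ : mu Lflat = 0) : (-1 : ℤ) ^ lam Lflat = -ZMod.χ₈ (N : ZMod 8) := by
  obtain ⟨σ, hσ, -, hW⟩ := exists_sign_isFrickeEigen hf
  obtain ⟨n, hn, hlt⟩ := exists_even_layer 2 (lam Lflat + 2)
  have hn2 : 2 ≤ n := by
    have h3 : 3 ≤ 2 ^ n := by omega
    rcases Nat.lt_or_ge n 2 with h | h
    · interval_cases n <;> simp at h3
    · exact h
  obtain ⟨Q, hQ⟩ := exists_integral_mazurTate_of_isSprungPair_two hf hgood hap hSP n
  obtain ⟨hΘ0, hμΘ, hlamΘ⟩ := lam_eq_lam_add_of_mu_eq_zero_of_even hap hn rfl hL0 hμ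
    (by omega : lam Lflat + (cyclotomicOmegaMinus 2 n).natDegree < 2 ^ n)
  have hbd : ∀ {Θ : IwasawaAlgebra 2} {d : ℕ}, lam Lflat + 2 + d < 2 ^ n → lam Θ = lam Lflat + d →
      lam Θ + 2 ≤ 2 ^ n := by intros; omega
  have key := neg_one_pow_lam_mazurTate_two hσ hW (not_dvd_level_of_isNewformOf hf hgood) hn2
    hQ.symm hΘ0 hμΘ (hbd hlt hlamΘ)
  rw [hlamΘ, pow_add, (odd_natDegree_cyclotomicOmegaMinus_two (by omega : 1 ≤ n)).neg_one_pow]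
    at key
  linear_combination -key

/-- **`λ(L♯) + λ(L♭)` is ODD at `p = 2`** (both colours non-zero with `μ = 0`). -/
theorem odd_lam_sharp_add_lam_flat_two (hf : IsNewformOf W f) (hgood : W.HasGoodReductionAtPrime 2)
    (hap : (2 : ℤ) ∣ W.frobeniusTrace 2) {Lsharp Lflat : IwasawaAlgebra 2}
    (hSP : IsSprungPair f 2 (W.frobeniusTrace 2) Lsharp Lflat) (hs0 : Lsharp ≠ 0)
    (hμs : mu Lsharp = 0) (hf0 : Lflat ≠ 0) (hμf : mu Lflat = 0) :
    Odd (lam Lsharp + lam Lflat) := by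
  have h1 := neg_one_pow_lam_sharp_two hf hgood hap hSP hs0 hμs
  have h2 := neg_one_pow_lam_flat_two hf hgood hap hSP hf0 hμf
  have hN2 := not_dvd_level_of_isNewformOf hf hgood
  have hprod : (-1 : ℤ) ^ (lam Lsharp + lam Lflat) = -1 := by
    rw [pow_add, h1, h2, mul_neg, ← sq]
    have hsq : ZMod.χ₈ (N : ZMod 8) ^ 2 = 1 := by
      rw [ZMod.χ₈_nat_eq_if_mod_eight, if_neg (by omega)]
      split_ifs <;> norm_num
    rw [hsq]
  rcases Nat.even_or_odd (lam Lsharp + lam Lflat) with h | h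
  · rw [h.neg_one_pow] at hprod; norm_num at hprod
  · exact h

/-- **Census form (o1 PARITY(2) law; typer L5 CORE): `Even λ(L♯₂) ↔ N ≡ ±1 (mod 8)`.** -/
theorem even_lam_sharp_two_iff (hf : IsNewformOf W f) (hgood : W.HasGoodReductionAtPrime 2)
    (hap : (2 : ℤ) ∣ W.frobeniusTrace 2) {Lsharp Lflat : IwasawaAlgebra 2}
    (hSP : IsSprungPair f 2 (W.frobeniusTrace 2) Lsharp Lflat) (hL0 : Lsharp ≠ 0)
    (hμ : mu Lsharp = 0) : Even (lam Lsharp) ↔ N % 8 = 1 ∨ N % 8 = 7 := by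
  have key := neg_one_pow_lam_sharp_two hf hgood hap hSP hL0 hμ
  have hN2 := not_dvd_level_of_isNewformOf hf hgood
  rw [ZMod.χ₈_nat_eq_if_mod_eight, if_neg (by omega)] at key
  constructor
  · intro hev
    by_contra hne
    rw [hev.neg_one_pow, if_neg hne] at key
    norm_num at key
  · intro h8
    rw [if_pos h8] at key
    exact (neg_one_pow_eq_one_iff_even (by norm_num)).mp key

/-- **`Even λ(L♭₂) ↔ N ≡ ±3 (mod 8)`.** -/
theorem even_lam_flat_two_iff (hf : IsNewformOf W f) (hgood : W.HasGoodReductionAtPrime 2)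
    (hap : (2 : ℤ) ∣ W.frobeniusTrace 2) {Lsharp Lflat : IwasawaAlgebra 2}
    (hSP : IsSprungPair f 2 (W.frobeniusTrace 2) Lsharp Lflat) (hL0 : Lflat ≠ 0)
    (hμ : mu Lflat = 0) : Even (lam Lflat) ↔ N % 8 = 3 ∨ N % 8 = 5 := by
  have key := neg_one_pow_lam_flat_two hf hgood hap hSP hL0 hμ
  have hN2 := not_dvd_level_of_isNewformOf hf hgood
  rw [ZMod.χ₈_nat_eq_if_mod_eight, if_neg (by omega)] at key
  constructor
  · intro hev
    rw [hev.neg_one_pow] at key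
    by_cases h8 : N % 8 = 1 ∨ N % 8 = 7
    · rw [if_pos h8] at key
      norm_num at key
    · omega
  · intro h8
    rw [if_neg (by omega), neg_neg] at key
    exact (neg_one_pow_eq_one_iff_even (by norm_num)).mp key

end TransferTwo

end Summit.BirchSwinnertonDyer.Rank1Residual.Supersingular

end
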